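import Summits.NavierStokesRegularity.FluidComputer.PalasekTowerRegisterGlobalAt
import Summits.NavierStokesRegularity.FluidComputer.PalasekTowerChainGluing
import Literature.Analysis.FluidPDE.AxisymmetricEuler

/-!
# REGISTER v2.3′ AT ARBITRARY RATES, IV: the LIVE-CLASS vocabulary — `DeadSlice`, `LiveStageAt R S s`,
# `LiveEpisodeBaseGAt R`, `LiveHeredityAtGAt R k`, `LiveHeredityFromGAt R k₀`, `LivePropagationAt R`, the comparisons
# with the G-layer and the repaired closer `closes_repairAt` (any `R`; tuned abbreviations)

Cell `ns-blowup`, seat `ns-blowup-fc-prover-2` (g9), landing VERBATIM the PTB tenure planner's shelf file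
`HOME/plan/ptb-liveclass/tuned/LiveClassRepairSketchAt.lean` (planner g23, sha16 76ba65f3f779844a; D-0014 ASK STATUS
2026-08-27T11:26Z (b), endorsed 11:51Z) into the `…PalasekTowerClayBridge` namespace beside the R-generic face layer
(`PalasekTowerFaceLayerAt{,Envelope}.lean`). LABEL: E–C typing (KERNEL vocabulary + glue). WHAT THIS IS NOT: not
Navier–Stokes evidence and NOT a route edit — named OPEN `Prop`s (the live-class REPAIR of the PTB cruxes, held on the
planner's shelf under the TRIGGER-ONLY ruling) and their glue; nothing is inhabited or asserted; no item is filed,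
restated or re-worded.

## Why (planner word, STATUS 2026-08-27T11:19Z / 11:26Z; cstrat-19179 g1 «mirrorT» flag)

A REGISTERED witness of the PTB cruxes in the STERILE class — a pinned-rigid-quiet design with a registered level-`k`
stage whose flow is axisymmetric WITHOUT swirl (globally regular: tree `Theorems/PalasekTowerBreakdownSterileTowerFinite.lean`,
`…EpisodeInductionNoSwirlForced.lean`) — would close `EpisodeBaseT` and refute `HeredityAtOneT ∧ HeredityFromTwoT` as
typed. The repair typed here, generically in the rates record `R`:
* `DeadSlice v` — in SOME rigid placement the slice is axisymmetric and swirl-free; `LiveStageAt R S s` — the readout slice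
  of the stage at its hand-over time `τ_k` is not dead;
* repaired cruxes `LiveEpisodeBaseGAt R` (∃ design + LIVE registered level-1 stage), `LiveHeredityAtGAt R k`,
  `LiveHeredityFromGAt R k₀` (heredity asked only OF live stages); tuned abbreviations `LiveEpisodeBaseT`,
  `LiveHeredityAtOneT`, `LiveHeredityFromTwoT`;
* ONE support statement `LivePropagationAt R` (`k ≥ 1`, unforced era under `Quiet`: a live parent hands over to a live
  child — content = rotation covariance of NS + backward uniqueness for classical bounded solutions; ESS-type);
* the chain is glued by the tree's `Realisation.ofChain` (ecbridge-1): `closes_repairAt` / `closes_repairT` = the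
  re-certified deciding theorem over FOUR statements; it elaborates now.
Comparisons: the repaired heredities are WEAKER than the items (`liveHeredityAtGAt_of_heredityAtGAt`, `…From…`); the
repaired base is STRONGER than `EpisodeBaseGAt` (a live witness is asked) — which is exactly why a sterile-class witness of
20303 would NOT survive the repair. So a LEAD's 20303 skeleton can carry ONE extra stub `stub_live : LiveStageAt tuned S s`
and conclude BOTH `EpisodeBaseT` (today's decl) and `LiveEpisodeBaseGAt tuned` (the shelf decl) from the same stubs.

References: S. Palasek, arXiv:2605.13827 §4 [cite: Palasek2026ElementaryModel, §4]; P. G. Lemarié-Rieusset, *The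
Navier–Stokes Problem in the 21st Century* (2016), Thm. 10.4 (axisymmetric flows without swirl are global)
[cite: LemarieRieusset2016, Thm 10.4 (p. 285)]; L. Escauriaza, G. Seregin, V. Šverák, Russian Math. Surveys 58 (2003)
(backward uniqueness) [cite: EscauriazaSereginSverak2003, Thm. 1.1]; C. L. Fefferman, Clay problem description, (C)
[cite: FeffermanClay2006, (C)].
-/

noncomputable section

namespace Summit.NavierStokesRegularity.FluidComputer.PalasekTowerClayBridge

open Set
open Literature.Analysis.FluidPDE

variable {R : TowerRates}

/-! ## §1 Dead slices, live stages -/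

/-- Rigid-motion conjugate of a velocity slice: `x ↦ A⁻¹ (v (A x + b))` for a linear isometry `A` of `ℝ³` and a
translation `b`. [folklore] -/
def conjSlice (A : EuclideanSpace ℝ (Fin 3) ≃ₗᵢ[ℝ] EuclideanSpace ℝ (Fin 3))
    (b : EuclideanSpace ℝ (Fin 3))
    (v : EuclideanSpace ℝ (Fin 3) → EuclideanSpace ℝ (Fin 3)) :
    EuclideanSpace ℝ (Fin 3) → EuclideanSpace ℝ (Fin 3) :=
  fun x => A.symm (v (A x + b))

/-- The conjugate by the identity placement is the slice itself. [folklore] -/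
@[simp] theorem conjSlice_refl_zero (v : EuclideanSpace ℝ (Fin 3) → EuclideanSpace ℝ (Fin 3)) :
    conjSlice (LinearIsometryEquiv.refl ℝ (EuclideanSpace ℝ (Fin 3))) 0 v = v := by
  funext x; simp only [conjSlice, add_zero]; rfl

/-- A velocity slice is DEAD if, in SOME rigid placement, it is axisymmetric AND swirl-free (the class in which
Navier–Stokes is globally regular: Ukhovskii–Yudovich, Ladyzhenskaya). [cite: LemarieRieusset2016, Thm 10.4 (p. 285)] -/
def DeadSlice (v : EuclideanSpace ℝ (Fin 3) → EuclideanSpace ℝ (Fin 3)) : Prop :=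
  ∃ (A : EuclideanSpace ℝ (Fin 3) ≃ₗᵢ[ℝ] EuclideanSpace ℝ (Fin 3)) (b : EuclideanSpace ℝ (Fin 3)),
    IsAxisymmetric (conjSlice A b v) ∧ HasNoSwirl (conjSlice A b v)

/-- An axisymmetric swirl-free slice is dead (identity placement). [folklore] -/
theorem deadSlice_of_isAxisymmetric_of_hasNoSwirl {v : EuclideanSpace ℝ (Fin 3) → EuclideanSpace ℝ (Fin 3)}
    (hax : IsAxisymmetric v) (hsw : HasNoSwirl v) : DeadSlice v :=
  ⟨LinearIsometryEquiv.refl ℝ _, 0, by rw [conjSlice_refl_zero]; exact hax, by rw [conjSlice_refl_zero]; exact hsw⟩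

/-- A registered level-`k` stage of the design `S` (rates `R`, unit viscosity, margins `routeG`) is LIVE if its readout
slice at the hand-over time `τ_k` is not dead. [cite: Palasek2026ElementaryModel, §4] -/
def LiveStageAt (R : TowerRates) (S : Schedule R) {k : ℕ} (s : Stage 1 R S (Margins.routeG R) k) : Prop :=
  ¬ DeadSlice (s.u (S.τ k))

/-! ## §2 The repaired cruxes and the support statement (open `Prop`s; never asserted) -/

/-- **Live heredity AT level `k`, rates `R`** (repaired `HeredityAtGAt R k`; open; never asserted): every LIVE registered
level-`k` stage of a pinned rigid quiet design on `R` extends to a registered stage at level `k + 1`.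
[cite: Palasek2026ElementaryModel, §4] -/
@[conjecture] def LiveHeredityAtGAt (R : TowerRates) (k : ℕ) : Prop :=
  ∀ S : Schedule R, S.Pins 8 (6 / 5) → S.Rigid → S.Quiet →
    ∀ s : Stage 1 R S (Margins.routeG R) k, LiveStageAt R S s →
      ∃ s' : Stage 1 R S (Margins.routeG R) (k + 1), s.Extends s'

/-- **Live heredity FROM level `k₀`, rates `R`** (repaired `HeredityFromGAt R k₀`; open; never asserted).
[cite: Palasek2026ElementaryModel, §4] -/
@[conjecture] def LiveHeredityFromGAt (R : TowerRates) (k₀ : ℕ) : Prop :=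
  ∀ S : Schedule R, S.Pins 8 (6 / 5) → S.Rigid → S.Quiet → ∀ k : ℕ, k₀ ≤ k →
    ∀ s : Stage 1 R S (Margins.routeG R) k, LiveStageAt R S s →
      ∃ s' : Stage 1 R S (Margins.routeG R) (k + 1), s.Extends s'

/-- **Live episode base, rates `R`** (repaired `EpisodeBaseGAt R`: the registered level-1 stage is LIVE; open; never
asserted). [cite: Palasek2026ElementaryModel, §4] -/
@[conjecture] def LiveEpisodeBaseGAt (R : TowerRates) : Prop :=
  ∃ S : Schedule R, S.Pins 8 (6 / 5) ∧ S.Rigid ∧ S.Quiet ∧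
    ∃ s : Stage 1 R S (Margins.routeG R) 1, LiveStageAt R S s

/-- **Support (backward-uniqueness content; open; never asserted)**: along a hand-over `k → k+1` with `k ≥ 1` (unforced
era under `Quiet`), a LIVE parent has a LIVE child — a dead readout slice at `τ_{k+1}` would force a dead slice at `τ_k`
(rotation covariance of NS + backward uniqueness for classical bounded solutions). [cite: EscauriazaSereginSverak2003, Thm. 1.1] -/
@[conjecture] def LivePropagationAt (R : TowerRates) : Prop :=
  ∀ S : Schedule R, S.Pins 8 (6 / 5) → S.Rigid → S.Quiet → ∀ k : ℕ, 1 ≤ k →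
    ∀ (s : Stage 1 R S (Margins.routeG R) k) (s' : Stage 1 R S (Margins.routeG R) (k + 1)),
      s.Extends s' → LiveStageAt R S s → LiveStageAt R S s'

/-! ## §3 The tuned instances (what the repaired route items would read) -/

/-- Repaired 20303′ at `TowerRates.tuned`. [cite: Palasek2026ElementaryModel, §4] -/
abbrev LiveEpisodeBaseT : Prop := LiveEpisodeBaseGAt TowerRates.tuned

/-- Repaired 20304′ at `TowerRates.tuned`. [cite: Palasek2026ElementaryModel, §4] -/
abbrev LiveHeredityAtOneT : Prop := LiveHeredityAtGAt TowerRates.tuned 1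

/-- Repaired 20305′ at `TowerRates.tuned`. [cite: Palasek2026ElementaryModel, §4] -/
abbrev LiveHeredityFromTwoT : Prop := LiveHeredityFromGAt TowerRates.tuned 2

/-- The support statement at `TowerRates.tuned`. [cite: EscauriazaSereginSverak2003, Thm. 1.1] -/
abbrev LivePropagationT : Prop := LivePropagationAt TowerRates.tuned

/-! ## §4 Comparisons with the G-layer -/

/-- The repaired heredity is WEAKER than `HeredityAtGAt R k`. [folklore] -/
theorem liveHeredityAtGAt_of_heredityAtGAt {k : ℕ} (h : HeredityAtGAt R k) : LiveHeredityAtGAt R k :=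
  fun S hP hR hQ s _ => h S hP hR hQ s

/-- The repaired heredity-from is WEAKER than `HeredityFromGAt R k₀`. [folklore] -/
theorem liveHeredityFromGAt_of_heredityFromGAt {k₀ : ℕ} (h : HeredityFromGAt R k₀) : LiveHeredityFromGAt R k₀ :=
  fun S hP hR hQ k hk s _ => h S hP hR hQ k hk s

/-- The repaired base is STRONGER than `EpisodeBaseGAt R`. [folklore] -/
theorem episodeBaseGAt_of_liveEpisodeBaseGAt (h : LiveEpisodeBaseGAt R) : EpisodeBaseGAt R := by
  obtain ⟨S, hP, hR, hQ, s, _⟩ := h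
  exact ⟨S, hP, hR, hQ, ⟨s⟩⟩

/-- **The base crux and its repair from ONE witness**: a pinned rigid quiet design on `R` with a LIVE registered level-1
stage gives BOTH `EpisodeBaseGAt R` (today's crux shape) and `LiveEpisodeBaseGAt R` (the repaired one) — the form a
line's `stub_live` feeds. [folklore] -/
theorem episodeBaseGAt_and_live_of_liveStage (S : Schedule R) (hP : S.Pins 8 (6 / 5)) (hR : S.Rigid) (hQ : S.Quiet)
    (s : Stage 1 R S (Margins.routeG R) 1) (hs : LiveStageAt R S s) :
    EpisodeBaseGAt R ∧ LiveEpisodeBaseGAt R :=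
  ⟨⟨S, hP, hR, hQ, ⟨s⟩⟩, ⟨S, hP, hR, hQ, s, hs⟩⟩

/-- Live heredity from `k₀` contains live heredity at every level `k ≥ k₀`. [folklore] -/
theorem LiveHeredityFromGAt.liveHeredityAt {k₀ k : ℕ} (h : LiveHeredityFromGAt R k₀) (hk : k₀ ≤ k) :
    LiveHeredityAtGAt R k :=
  fun S hP hR hQ s hs => h S hP hR hQ k hk s hs

/-- Peeling glue for the repaired split: live heredity at `k₀` and from `k₀ + 1` give live heredity from `k₀`.
[folklore] -/
theorem LiveHeredityAtGAt.liveHeredityFrom {k₀ : ℕ} (h₀ : LiveHeredityAtGAt R k₀)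
    (h₁ : LiveHeredityFromGAt R (k₀ + 1)) : LiveHeredityFromGAt R k₀ := by
  intro S hP hR hQ k hk s hs
  rcases hk.eq_or_lt with rfl | hlt
  · exact h₀ S hP hR hQ s hs
  · exact h₁ S hP hR hQ k hlt s hs

/-- The repaired split is lossless: `LiveHeredityFromGAt R k₀ ↔ LiveHeredityAtGAt R k₀ ∧ LiveHeredityFromGAt R (k₀+1)`.
[folklore] -/
theorem liveHeredityFromGAt_iff (k₀ : ℕ) :
    LiveHeredityFromGAt R k₀ ↔ LiveHeredityAtGAt R k₀ ∧ LiveHeredityFromGAt R (k₀ + 1) :=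
  ⟨fun h => ⟨h.liveHeredityAt le_rfl, fun S hP hR hQ k hk s hs => h S hP hR hQ k ((Nat.le_succ k₀).trans hk) s hs⟩,
    fun h => h.1.liveHeredityFrom h.2⟩

/-! ## §5 The repaired deciding theorem, any rates `R` -/

/-- **Repaired closer at rates `R`**: live base + live heredity at `1` + live heredity from `2` + live propagation ⇒
Clay (C). The live chain is chosen inside the subtype of live stages and glued by the tree's `Realisation.ofChain`;
Path B (unconditional uniqueness) closes. [cite: FeffermanClay2006, (C)] -/
theorem closes_repairAt (h₁ : LiveEpisodeBaseGAt R) (h₂ : LiveHeredityAtGAt R 1) (h₃ : LiveHeredityFromGAt R 2)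
    (h₄ : LivePropagationAt R) :
    Summit.NavierStokesRegularity.NavierStokesRegularity.NavierStokesBreakdownR3 := by
  classical
  obtain ⟨S, hP, hR, hQ, s₁, hs₁⟩ := h₁
  have hF : LiveHeredityFromGAt R 1 := h₂.liveHeredityFrom h₃
  have step : ∀ n : ℕ, ∀ s : Stage 1 R S (Margins.routeG R) (n + 1),
      LiveStageAt R S s → ∃ s' : Stage 1 R S (Margins.routeG R) (n + 1 + 1),
        s.Extends s' ∧ LiveStageAt R S s' := by
    intro n s hs
    obtain ⟨s', hs'⟩ := hF S hP hR hQ (n + 1) (by omega) s hs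
    exact ⟨s', hs', h₄ S hP hR hQ (n + 1) (by omega) s s' hs' hs⟩
  let T : ℕ → Type := fun n => {s : Stage 1 R S (Margins.routeG R) (n + 1) // LiveStageAt R S s}
  let nxt : (n : ℕ) → T n → T (n + 1) := fun n t =>
    ⟨Classical.choose (step n t.1 t.2), (Classical.choose_spec (step n t.1 t.2)).2⟩
  let ch : (n : ℕ) → T n := fun n => Nat.rec (motive := fun n => T n) ⟨s₁, hs₁⟩ nxt n
  have hch : ∀ n, (ch n).1.Extends (ch (n + 1)).1 := fun n =>
    (Classical.choose_spec (step n (ch n).1 (ch n).2)).1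
  exact navierStokesBreakdownR3_of_step2_B R
    (palasekStep2_of_realisation one_pos (Realisation.ofChain S (fun n => (ch n).1) hch))

/-- **Repaired closer at the tuned rates** (the `closes` of the repaired route, four binders).
[cite: FeffermanClay2006, (C)] -/
theorem closes_repairT (h₁ : LiveEpisodeBaseT) (h₂ : LiveHeredityAtOneT) (h₃ : LiveHeredityFromTwoT)
    (h₄ : LivePropagationT) :
    Summit.NavierStokesRegularity.NavierStokesRegularity.NavierStokesBreakdownR3 :=
  closes_repairAt h₁ h₂ h₃ h₄

/-- **Today's closer survives the repair trivially in one direction**: the G-layer items imply the repaired heredities,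
so `EpisodeBase`-live + the items of record + live propagation also close (any `R`). [cite: FeffermanClay2006, (C)] -/
theorem navierStokesBreakdownR3_of_live_base_heredityGAt (h₁ : LiveEpisodeBaseGAt R) (h₂ : HeredityAtGAt R 1)
    (h₃ : HeredityFromGAt R 2) :
    Summit.NavierStokesRegularity.NavierStokesRegularity.NavierStokesBreakdownR3 :=
  navierStokesBreakdownR3_of_heredityGAt (episodeBaseGAt_of_liveEpisodeBaseGAt h₁) h₂ h₃

end Summit.NavierStokesRegularity.FluidComputer.PalasekTowerClayBridge

end
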